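import Literature.Probability.RandomPlanarGeometry.SAWBendingEnergy
import Mathlib.Analysis.Subadditive
import HarnessLib

/-!
# The bending free energy of self-avoiding walks exists: `log Z_N(t)/N → κ(t)` (lane «STIFF», item F1)

Topic `Literature/Probability/RandomPlanarGeometry` (continues `SAWBendingEnergy.lean`: `Zd.turns`, `Zd.Zbend`, `Zd.bendFE`,
`wturns`, `Zbend_eq_sum_sawWords`; `SAWWords.lean`: `sawWords`, `IsSAW.take`, `IsSAW.drop`).

Source for the mechanism: N. Madras, G. Slade, *The Self-Avoiding Walk* (1993), §1.2, eqs. (1.2.3)–(1.2.9): `c_{n+m} ≤ c_n c_m`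
by splitting a walk, and Fekete's lemma, give `μ = lim c_n^{1/n} = inf c_n^{1/n}`. Here the same splitting is run WITH THE
BENDING WEIGHT `t^{turns}` (semi-flexible walks): the two pieces carry all turns except possibly the one at the junction, so
`Z_{n+m}(t) ≤ max(1,t) · Z_n(t) Z_m(t)` (`Zbend_add_le`); hence `N ↦ log(max(1,t) Z_N(t))` is subadditive and `≥ 0` (the
straight walk has no turn), and Mathlib's `Subadditive.tendsto_lim` gives the limit, which is the lane's `Zd.bendFE t` (defined
as the corresponding infimum). Lane «pcv-sawmu» route «STIFF» (§37), item F1 (`BendFE_exists` of the planner's `Sketch_v7.lean`,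
a-idea-2 g8; its body is the statement of `Zd.tendsto_log_Zbend_div` verbatim).

## Contents (namespace `Literature.Probability.RandomPlanarGeometry.SAW`; theorems only)
`wturns_append_le`, `le_wturns_append` (turns of a concatenated word), `Zd.turns_straightWalk`, `Zd.one_le_Zbend`,
`Zd.Zbend_add_le` (weighted submultiplicativity), `Zd.bendFE_le_div` (`κ(t) ≤ log(max(1,t) Z_N(t))/N`, `N ≥ 1`),
**`Zd.tendsto_log_Zbend_div`** (F1: `log Z_N(t)/N → κ(t)` for `t > 0`), `Zd.tendsto_log_max_mul_Zbend_div`.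
Tree-twin search: stems `Zbend`, `bendFE`, `wturns_append` → only `SAWBendingEnergy.lean` / `SAWBendingEnergyPDLower.lean`
(objects, dictionary, a lower bound; no limit statement). No twin.
-/

noncomputable section

open Finset Filter Topology
open scoped BigOperators
open Literature.Probability.LatticeModels

namespace Literature.Probability.RandomPlanarGeometry.SAW

/-! ### Turns of a concatenation -/

/-- Prepending one letter adds at most one turn. [cite: MadrasSlade1993, §1.2, eq. (1.2.3) (splitting a walk)] -/
theorem wturns_cons_le (a : Step) (v : List Step) : wturns (a :: v) ≤ wturns v + 1 := by
  cases v with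
  | nil => simp
  | cons b w => rw [wturns_cons_cons]; split_ifs <;> omega

/-- Prepending one letter does not remove turns. [cite: MadrasSlade1993, §1.2, eq. (1.2.3) (splitting a walk)] -/
theorem wturns_le_wturns_cons (a : Step) (v : List Step) : wturns v ≤ wturns (a :: v) := by
  cases v with
  | nil => simp
  | cons b w => rw [wturns_cons_cons]; omega

/-- **Turns of a concatenation, upper bound**: `wturns (u ++ v) ≤ wturns u + wturns v + 1` (the only possibly new
turn is at the junction). [cite: MadrasSlade1993, §1.2, eq. (1.2.3) (splitting a walk)] -/
theorem wturns_append_le : ∀ (u v : List Step), wturns (u ++ v) ≤ wturns u + wturns v + 1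
  | [], v => by simp
  | [a], v => by simpa using wturns_cons_le a v
  | a :: b :: u, v => by
    have ih := wturns_append_le (b :: u) v
    simp only [List.cons_append, wturns_cons_cons] at ih ⊢
    omega

/-- **Turns of a concatenation, lower bound**: `wturns u + wturns v ≤ wturns (u ++ v)`.
[cite: MadrasSlade1993, §1.2, eq. (1.2.3) (splitting a walk)] -/
theorem le_wturns_append : ∀ (u v : List Step), wturns u + wturns v ≤ wturns (u ++ v)
  | [], v => by simp
  | [a], v => by simpa using wturns_le_wturns_cons a v
  | a :: b :: u, v => by
    have ih := le_wturns_append (b :: u) v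
    simp only [List.cons_append, wturns_cons_cons] at ih ⊢
    omega

/-- The junction inequality for the weights: if `T ≤ k ≤ T + 1` then `t^k ≤ max(1,t) · t^T` (`t > 0`).
[cite: MadrasSlade1993, §1.2, eq. (1.2.3) (weighted form)] -/
theorem pow_le_max_mul_pow {t : ℝ} (ht : 0 < t) {k T : ℕ} (h1 : T ≤ k) (h2 : k ≤ T + 1) :
    t ^ k ≤ max 1 t * t ^ T := by
  rcases le_or_gt 1 t with ht1 | ht1
  · rw [max_eq_right ht1]
    calc t ^ k ≤ t ^ (T + 1) := pow_le_pow_right₀ ht1 h2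
      _ = t * t ^ T := by rw [pow_succ]; ring
  · rw [max_eq_left ht1.le, one_mul]
    exact pow_le_pow_of_le_one ht.le ht1.le h1

namespace Zd

/-! ### `Z_N(t) ≥ 1` and the weighted submultiplicativity -/

/-- The straight walk has no turn. [cite: MadrasSlade1993, §1.2 (the straight walk)] -/
theorem turns_straightWalk (N : ℕ) : turns N (straightWalk 2 N) = 0 := by
  classical
  unfold turns occ
  rw [Finset.card_eq_zero, Finset.filter_eq_empty_iff]
  rintro j - ⟨hj2, hne⟩
  apply hne
  simp only [straightWalk, min_eq_left (show j + 2 ≤ N by omega), min_eq_left (show j + 1 ≤ N by omega),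
    min_eq_left (show j ≤ N by omega)]
  rw [← Pi.single_sub, ← Pi.single_sub]
  congr 1
  push_cast
  ring

/-- `Z_N(t) ≥ 1` for `t > 0` (the straight walk contributes `t⁰ = 1`). [cite: MadrasSlade1993, §1.2 (the straight walk)] -/
theorem one_le_Zbend (N : ℕ) {t : ℝ} (ht : 0 < t) : 1 ≤ Zbend N t := by
  unfold Zbend
  have h := Finset.single_le_sum (f := fun ω : ℕ → Site 2 => t ^ turns N ω) (fun ω _ => pow_nonneg ht.le _)
    (straightWalk_mem_saws 2 N)
  simpa [turns_straightWalk] using h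

/-- `Z_N(t) > 0` for `t > 0`. [cite: MadrasSlade1993, §1.2] -/
theorem Zbend_pos (N : ℕ) {t : ℝ} (ht : 0 < t) : 0 < Zbend N t := lt_of_lt_of_le one_pos (one_le_Zbend N ht)

/-- **Weighted submultiplicativity**: `Z_{n+m}(t) ≤ max(1,t) · Z_n(t) · Z_m(t)` for `t > 0`. Split an
`(n+m)`-step self-avoiding word into its first `n` letters and the rest (both self-avoiding); all turns but the one at
the junction are turns of the pieces. [cite: MadrasSlade1993, §1.2, eq. (1.2.3) (weighted form)] -/
theorem Zbend_add_le (n m : ℕ) {t : ℝ} (ht : 0 < t) :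
    Zbend (n + m) t ≤ max 1 t * Zbend n t * Zbend m t := by
  classical
  rw [Zbend_eq_sum_sawWords, Zbend_eq_sum_sawWords, Zbend_eq_sum_sawWords]
  have hM : 0 ≤ max 1 t := le_trans zero_le_one (le_max_left _ _)
  -- the splitting map `w ↦ (w.take n, w.drop n)` and its properties
  have hmaps : ∀ w ∈ sawWords (n + m),
      (fun w : List Step => (w.take n, w.drop n)) w ∈ sawWords n ×ˢ sawWords m := by
    intro w hw
    rw [mem_sawWords] at hw
    simp only [Finset.mem_product, mem_sawWords, List.length_take, List.length_drop, hw.1]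
    exact ⟨⟨by omega, hw.2.take n⟩, ⟨by omega, hw.2.drop n⟩⟩
  have hinj : Set.InjOn (fun w : List Step => (w.take n, w.drop n)) ↑(sawWords (n + m)) := by
    intro w _ w' _ h
    simp only [Prod.mk.injEq] at h
    rw [← List.take_append_drop n w, ← List.take_append_drop n w', h.1, h.2]
  -- termwise: `t^{wturns w} ≤ max(1,t) t^{wturns (take)} t^{wturns (drop)}`
  have hterm : ∀ w ∈ sawWords (n + m),
      t ^ wturns w ≤ max 1 t * (t ^ wturns (w.take n) * t ^ wturns (w.drop n)) := by
    intro w _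
    have e : w = w.take n ++ w.drop n := (List.take_append_drop n w).symm
    have h1 := le_wturns_append (w.take n) (w.drop n)
    have h2 := wturns_append_le (w.take n) (w.drop n)
    rw [← e] at h1 h2
    rw [← pow_add]
    exact pow_le_max_mul_pow ht h1 h2
  have hprod : ∑ p ∈ sawWords n ×ˢ sawWords m, t ^ wturns p.1 * t ^ wturns p.2 =
      (∑ u ∈ sawWords n, t ^ wturns u) * ∑ v ∈ sawWords m, t ^ wturns v := by
    rw [Finset.sum_product, Finset.sum_mul_sum]
  calc ∑ w ∈ sawWords (n + m), t ^ wturns w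
      ≤ ∑ w ∈ sawWords (n + m), max 1 t * (t ^ wturns (w.take n) * t ^ wturns (w.drop n)) :=
        Finset.sum_le_sum hterm
    _ = max 1 t * ∑ w ∈ sawWords (n + m),
          (fun p : List Step × List Step => t ^ wturns p.1 * t ^ wturns p.2)
            ((fun w : List Step => (w.take n, w.drop n)) w) := by
        rw [Finset.mul_sum]
    _ = max 1 t * ∑ p ∈ (sawWords (n + m)).image (fun w : List Step => (w.take n, w.drop n)),
          t ^ wturns p.1 * t ^ wturns p.2 := by
        rw [Finset.sum_image hinj]
    _ ≤ max 1 t * ∑ p ∈ sawWords n ×ˢ sawWords m, t ^ wturns p.1 * t ^ wturns p.2 := by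
        apply mul_le_mul_of_nonneg_left _ hM
        refine Finset.sum_le_sum_of_subset_of_nonneg (fun p hp => ?_) fun p _ _ => by positivity
        obtain ⟨w, hw, rfl⟩ := Finset.mem_image.1 hp
        exact hmaps w hw
    _ = max 1 t * (∑ u ∈ sawWords n, t ^ wturns u) * ∑ v ∈ sawWords m, t ^ wturns v := by
        rw [hprod, mul_assoc]

/-! ### Fekete: the free energy exists and equals `κ(t)` -/

/-- **`κ(t) ≤ log(max(1,t) Z_N(t))/N` for every `N ≥ 1`** (the infimum defining `κ`).
[cite: MadrasSlade1993, §1.2, eq. (1.2.9) (Fekete characterisation, weighted form)] -/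
theorem bendFE_le_div {t : ℝ} (ht : 0 < t) {N : ℕ} (hN : 1 ≤ N) :
    bendFE t ≤ Real.log (max 1 t * Zbend N t) / N := by
  obtain ⟨n, rfl⟩ : ∃ n, N = n + 1 := ⟨N - 1, by omega⟩
  have hbdd : BddBelow (Set.range fun n : ℕ => Real.log (max 1 t * Zbend (n + 1) t) / ((n : ℝ) + 1)) := by
    refine ⟨0, ?_⟩
    rintro _ ⟨k, rfl⟩
    refine div_nonneg (Real.log_nonneg ?_) (by positivity)
    have h1 : 1 ≤ max 1 t := le_max_left _ _
    have h2 := one_le_Zbend (k + 1) ht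
    nlinarith
  have := ciInf_le hbdd n
  unfold bendFE
  push_cast
  exact this

/-- **F1 — the bending free energy exists (lane «STIFF», `BendFE_exists`)**: for every `t > 0`,
`log Z_N(t)/N → κ(t) = Zd.bendFE t`. [cite: MadrasSlade1993, §1.2, eqs. (1.2.3)–(1.2.9) (Fekete, weighted form)] -/
theorem tendsto_log_Zbend_div {t : ℝ} (ht : 0 < t) :
    Tendsto (fun N : ℕ => Real.log (Zbend N t) / N) atTop (𝓝 (bendFE t)) := by
  have hM : 0 < max 1 t := lt_of_lt_of_le one_pos (le_max_left _ _)
  have hZ : ∀ N, 0 < Zbend N t := fun N => Zbend_pos N ht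
  set u : ℕ → ℝ := fun N => Real.log (max 1 t * Zbend N t) with hu
  have hsub : Subadditive u := by
    intro n m
    simp only [hu]
    rw [← Real.log_mul (mul_pos hM (hZ n)).ne' (mul_pos hM (hZ m)).ne']
    apply Real.log_le_log (mul_pos hM (hZ _))
    have := Zbend_add_le n m ht
    calc max 1 t * Zbend (n + m) t ≤ max 1 t * (max 1 t * Zbend n t * Zbend m t) :=
          mul_le_mul_of_nonneg_left this hM.le
      _ = max 1 t * Zbend n t * (max 1 t * Zbend m t) := by ring
  have hu0 : ∀ N, 0 ≤ u N := fun N => by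
    simp only [hu]
    refine Real.log_nonneg ?_
    have h1 : 1 ≤ max 1 t := le_max_left _ _
    have h2 := one_le_Zbend N ht
    nlinarith
  have hbdd : BddBelow (Set.range fun n : ℕ => u n / n) := by
    refine ⟨0, ?_⟩
    rintro _ ⟨n, rfl⟩
    exact div_nonneg (hu0 n) (Nat.cast_nonneg n)
  have hlim := hsub.tendsto_lim hbdd
  -- identify the Fekete limit with `bendFE t`
  have hbdd' : BddBelow (Set.range fun n : ℕ => Real.log (max 1 t * Zbend (n + 1) t) / ((n : ℝ) + 1)) := by
    refine ⟨0, ?_⟩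
    rintro _ ⟨k, rfl⟩
    exact div_nonneg (hu0 (k + 1)) (by positivity)
  have heq : hsub.lim = bendFE t := by
    apply le_antisymm
    · refine le_ciInf fun n => ?_
      have h1 := hsub.lim_le_div hbdd (Nat.succ_ne_zero n)
      simpa [hu, Nat.cast_succ] using h1
    · refine ge_of_tendsto hlim ?_
      filter_upwards [eventually_ge_atTop 1] with N hN
      exact bendFE_le_div ht hN
  -- remove the constant `log max(1,t)`
  have hsplit : ∀ N : ℕ, Real.log (Zbend N t) / N = u N / N - Real.log (max 1 t) * (1 / (N : ℝ)) := by
    intro N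
    simp only [hu]
    rw [Real.log_mul hM.ne' (hZ N).ne']
    ring
  have h0 : Tendsto (fun N : ℕ => Real.log (max 1 t) * (1 / (N : ℝ))) atTop (𝓝 0) := by
    have := tendsto_one_div_atTop_nhds_zero_nat.const_mul (Real.log (max 1 t))
    simpa using this
  have := hlim.sub h0
  rw [heq, sub_zero] at this
  refine this.congr fun N => (hsplit N).symm

/-- The Fekete form itself: `log(max(1,t) Z_N(t))/N → κ(t)`. [cite: MadrasSlade1993, §1.2, eq. (1.2.9) (weighted form)] -/
theorem tendsto_log_max_mul_Zbend_div {t : ℝ} (ht : 0 < t) :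
    Tendsto (fun N : ℕ => Real.log (max 1 t * Zbend N t) / N) atTop (𝓝 (bendFE t)) := by
  have hM : 0 < max 1 t := lt_of_lt_of_le one_pos (le_max_left _ _)
  have h0 : Tendsto (fun N : ℕ => Real.log (max 1 t) * (1 / (N : ℝ))) atTop (𝓝 0) := by
    have := tendsto_one_div_atTop_nhds_zero_nat.const_mul (Real.log (max 1 t))
    simpa using this
  have := (tendsto_log_Zbend_div ht).add h0
  rw [add_zero] at this
  refine this.congr fun N => ?_
  rw [Real.log_mul hM.ne' (Zbend_pos N ht).ne']
  ring

end Zd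

end Literature.Probability.RandomPlanarGeometry.SAW

end
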